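import Literature.MathematicalPhysics.QuantumFieldTheory.Balaban1983to89.Node00.Record8Chart

/-!
# NODE 00 (YM-PLAN Track A) — THE β-CHART OF RECORD AS A DEFINITION, every `N`: `suChartMap N : ℝ^{d(N)} →L[ℝ] M_N(ℂ)`, an `hsForm`-orthonormal chart
# of 𝔰𝔲(N) CHOSEN from the landed existence theorem (`Record8Chart.exists_isSuChart_one` — no junk branch), the re-charting `Stage8Params.rechart θ`, and the
# β of record read through it (`rfl`) — the displayed chart INSTANCES a Stage-9 record's chart clause (`Admissible₉ ∋ IsChartOfRecord cβ`) asks for, every `N`,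
# and the ₈-level record predicate charted BY DEFINITION `IsRecordOfRecord₈R` (→ ₈X → ₈C)

NODE 00 STAGE-8∕9 SUPPLY MODULE (seat `pub-ymgap-dag-n23-b` g2, 2026-08-26; HUMAN RULING D-0062; pub-ymgap chair R445 (a5) «chart clause of record … definition-level
item for the ₉ pin», ZEROCHART rider v0.33; plan g62 rev-1 acceptance test (I3-chart) «₉C refines `IsRecordOfRecord₈X` ∕ conjoins `IsChartOfRecord`, `rho8_ne_zero`»;
R433 «pins, not guards»).  APPEND-ONLY GROWTH: a NEW importing module; nothing landed is edited.
WHAT IS DEFINED (definitions with bodies; `Classical.choose` ONLY from a PROVED existence, chair R434 (c2) idiom without a junk branch):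
* `suChartDim N : ℕ`, `suChartMap N : (Fin (suChartDim N) → ℝ) →L[ℝ] Matrix (Fin N) (Fin N) ℂ` — THE CHART OF RECORD: `ℝ^d` with its standard basis mapped onto
  an `hsForm`-ORTHONORMAL real basis of 𝔰𝔲(N) (`Re Tr(G_aᴴ G_b) = δ_{ab}`; normalisation constant `c = 1`), chosen from `exists_isSuChart_one`; spec
  `isSuChart_suChartMap : IsSuChart N (suChartMap N) (Pi.basisFun ℝ _) 1`; consequences `suChartMap_mem` (values traceless skew-Hermitian), `suChartMap_onto`,
  `hsForm_suChartMap_single`, `suChartMap_ne_zero` (`2 ≤ N`), `suChartMap_eq_zero_of_one` (`N = 1`: 𝔰𝔲(1) = 0).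
* `Stage8Params.rechart θ` — a Stage-8 parameter RE-CHARTED by the chart of record (same Stage-7 parameters, `εbg`, base histories `v₀`); `toStage7Params_rechart`,
  `rechart_εbg`, `rechart_γ` (`rfl`), `admissible_rechart_iff` (`Iff.rfl`), `isChartOfRecord_rechart` (the chart clause of record with `c = 1`),
  `rho8_rechart_ne_zero`, **`betaOfRecord₈_rechart`** (`rfl`: the Stage-8 β of record READ THROUGH the chart of record — the displayed non-degenerate chart
  instance of ZEROCHART v0.33 (a2), every `N`), `isRecordOfRecord₈X_rechart` (every admissible θ, re-charted, IS a ₈X record at a world with any window),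
  `exists_isRecordOfRecord₈X_rechart`.
* §3 `IsRecordOfRecord₈R` — the Stage-8 record predicate CHARTED BY DEFINITION (witness re-charted by `rechart`; no chart quantified over): refinements
  `→ IsRecordOfRecord₈X → IsRecordOfRecord₈C`, `exists_βfun_of_isRecordOfRecord₈R`, pointed form, `exists_isRecordOfRecord₈R` (INHABITED-AT-₈R, every `N`).
READING FOR STAGE 9 (node00-def-T g2's `Record9` INTENT-3, pub-ymgap INBOX l.10658: `Stage9Params extends Stage8Params`, `Admissible₉ := Admissible₈ ∧ 0 < cβ ∧
toStage8Params.IsChartOfRecord cβ ∧ …` — the ₈X clause VERBATIM; `betaOfRecord₉ := betaOfRecord₈ θ.toStage8Params`): this file supplies the INSTANCES such a record needs —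
for every admissible Stage-8 parameter `θ`, `θ.rechart` satisfies the clause with `cβ = 1` (`isChartOfRecord_rechart`), its β of record is displayed by `rfl`
(`betaOfRecord₈_rechart`), and a Stage-9 parameter extending `θ.rechart` meets the chart conjunct of `Admissible₉` by `isSuChart_suChartMap`; the ₈-level predicate
charted BY DEFINITION (`IsRecordOfRecord₈R`, §3) is the «pins, not guards» twin of ₈X for consumers that prefer no chart quantifier.  (₉C's datum is a TOWER datum —
`datumOfTower` — so ₉C refines ₈X∕₈R only through def-T's shadow∕agreement lemmas, not at the datum; the chart objects here are datum-independent.)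
NORMALISATION: print's (1.21)₁ `Π^{ab} = δ^{ab}Π` fixes
orthogonality of the colour components; the overall constant (`c = 1` here = Hilbert–Schmidt-orthonormal `Re Tr(XᴴY)`) is a CONVENTION — β read through a
basis of squared norms `c` is `c` times β read through an orthonormal one (`polScalar` averages `Π^{aa}`); matching King's ∕ [I] §5's one-loop number is NODE O's
bookkeeping, not asserted here.
HONEST FRAMING: definitions about the SHAPE of the β-chart + `rfl` bookkeeping; no estimate; nothing of Bałaban's asserted; count-neutral; one finite T⁴ at fixed ε
— NOT continuum ∕ ℝ⁴ ∕ OS ∕ mass gap ∕ Clay.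
-/

noncomputable section

open MeasureTheory Filter
open scoped Matrix.Norms.L2Operator

namespace Literature.MathematicalPhysics.QuantumFieldTheory.Balaban1983to89.Node00

open FlowStep FlowStepRuns T4DatumAssembly
open T4Continuum (T4Family FiniteEpsData)
open T4FiniteEpsInhabited (zeroHBeta)
open DagBinding (WorldP)
open Literature.Algebra.Lie.CompactKillingForm (hsForm)
open Matrix

variable (F : T4Family) (N : ℕ) [NeZero N]

/-! ## §1. The chart of record, every `N` -/

section Chart
omit [NeZero N]

/-- **The dimension index of the chart of record** (the `d` of `Record8Chart.exists_isSuChart_one`; abstractly `dim_ℝ 𝔰𝔲(N) = N² − 1`, not computed here).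
[cite: Hall2015, Example 7.3] -/
def suChartDim : ℕ := Classical.choose (exists_isSuChart_one (N := N))

/-- **THE β-CHART OF RECORD**: `ℝ^{d(N)} → M_N(ℂ)`, the standard basis mapped onto an `hsForm`-orthonormal real basis of 𝔰𝔲(N) — CHOSEN from the proved existence
`exists_isSuChart_one` (Gram–Schmidt for `Re Tr(XᴴY)` on `suAlgebra N`); print's colour components `B^a` of `B ∈ 𝔰𝔲(N)` in `U_{j+1}(exp iB)`.
[cite: Balaban1987RG1, p.264 (before (1.20)) and (1.21) p.264; Hall2015, Example 7.3] -/
def suChartMap : (Fin (suChartDim N) → ℝ) →L[ℝ] Matrix (Fin N) (Fin N) ℂ :=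
  Classical.choose (Classical.choose_spec (exists_isSuChart_one (N := N)))

/-- **Spec: the chart of record IS a chart of 𝔰𝔲(N) with `hsForm`-orthonormal standard basis (`c = 1`).** [cite: Balaban1987RG1, (1.20)–(1.21) p.264] -/
theorem isSuChart_suChartMap : IsSuChart N (suChartMap N) (Pi.basisFun ℝ (Fin (suChartDim N))) 1 :=
  Classical.choose_spec (Classical.choose_spec (exists_isSuChart_one (N := N)))

/-- Chart values are traceless skew-Hermitian (∈ 𝔰𝔲(N)). [cite: Hall2015, Example 7.3] -/
theorem suChartMap_mem (x : Fin (suChartDim N) → ℝ) : (suChartMap N x)ᴴ = -(suChartMap N x) ∧ (suChartMap N x).trace = 0 :=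
  (isSuChart_suChartMap N).1 x

/-- The chart of record is ONTO 𝔰𝔲(N). [cite: Hall2015, Example 7.3] -/
theorem suChartMap_onto (X : Matrix (Fin N) (Fin N) ℂ) (hXh : Xᴴ = -X) (hXt : X.trace = 0) : ∃ x : Fin (suChartDim N) → ℝ, suChartMap N x = X :=
  (isSuChart_suChartMap N).2.1 X hXh hXt

/-- The standard basis read through the chart of record is Hilbert–Schmidt-ORTHONORMAL. [cite: Balaban1987RG1, (1.21) p.264; Hall2015, Exercise 7.3] -/
theorem hsForm_suChartMap_single (a b : Fin (suChartDim N)) :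
    hsForm (Fin N) (suChartMap N (Pi.single a 1)) (suChartMap N (Pi.single b 1)) = if a = b then 1 else 0 := by
  have h := isSuChart_suChartMap N
  split_ifs with hab
  · subst hab
    simpa only [Pi.basisFun_apply] using h.2.2.1 a
  · simpa only [Pi.basisFun_apply] using h.2.2.2 a b hab

/-- **The chart of record is NOT the zero map (`2 ≤ N`)** — the zero-chart junk of `Record8Inhabited` is excluded by definition. [cite: Balaban1987RG1, (1.20)–(1.21) p.264 (bookkeeping)] -/
theorem suChartMap_ne_zero (hN : 2 ≤ N) : suChartMap N ≠ 0 :=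
  (isSuChart_suChartMap N).ne_zero_of_two_le one_pos hN

/-- At `N = 1` the chart of record IS the zero map (𝔰𝔲(1) = 0). [cite: Hall2015, Example 7.3 (bookkeeping)] -/
theorem suChartMap_eq_zero_of_one : suChartMap 1 = 0 :=
  (isSuChart_suChartMap 1).eq_zero_of_one

end Chart

/-! ## §2. Stage-8 parameters RE-CHARTED by the chart of record -/

variable {F N}

/-- **A Stage-8 parameter RE-CHARTED BY THE CHART OF RECORD**: same Stage-7 parameters, background radius `εbg` and base histories `v₀`; `Vβ := ℝ^{d(N)}`,
`ρ8 := suChartMap N`, `bV :=` the standard basis. [cite: Balaban1987RG1, (1.20)–(1.21) p.264] -/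
def Stage8Params.rechart (θ : Stage8Params F N) : Stage8Params F N where
  toStage7Params := θ.toStage7Params
  εbg := θ.εbg
  Vβ := Fin (suChartDim N) → ℝ
  ιβ := Fin (suChartDim N)
  ρ8 := suChartMap N
  bV := Pi.basisFun ℝ (Fin (suChartDim N))
  v₀ := θ.v₀

/-- Re-charting keeps the Stage-7 parameters (`rfl`). [cite: Balaban1987RG1, (0.21) p.256 (bookkeeping)] -/
theorem Stage8Params.toStage7Params_rechart (θ : Stage8Params F N) : θ.rechart.toStage7Params = θ.toStage7Params := rfl

/-- … the background radius (`rfl`). [cite: Balaban1987RG1, (0.21) p.256 (bookkeeping)] -/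
theorem Stage8Params.rechart_εbg (θ : Stage8Params F N) : θ.rechart.εbg = θ.εbg := rfl

/-- … the box radius (`rfl`). [cite: Balaban1989LargeFieldII, Thm 1 p.355 (bookkeeping)] -/
theorem Stage8Params.rechart_γ (θ : Stage8Params F N) : θ.rechart.γ = θ.γ := rfl

/-- … and admissibility (`Iff.rfl`). [cite: Balaban1987RG1, (0.21) p.256 (bookkeeping)] -/
theorem Stage8Params.admissible_rechart_iff (θ : Stage8Params F N) : θ.rechart.Admissible ↔ θ.Admissible := Iff.rfl

/-- **The re-charted parameter carries THE CHART CLAUSE OF RECORD (`c = 1`).** [cite: Balaban1987RG1, (1.20)–(1.21) p.264] -/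
theorem Stage8Params.isChartOfRecord_rechart (θ : Stage8Params F N) : θ.rechart.IsChartOfRecord 1 :=
  isSuChart_suChartMap N

/-- … hence its chart is non-zero for `2 ≤ N`. [cite: Balaban1987RG1, (1.20)–(1.21) p.264 (bookkeeping)] -/
theorem Stage8Params.rho8_rechart_ne_zero (θ : Stage8Params F N) (hN : 2 ≤ N) : θ.rechart.ρ8 ≠ 0 :=
  suChartMap_ne_zero N hN

/-- **THE β OF RECORD READ THROUGH THE CHART OF RECORD, unfolded** (`rfl`): `betaOfRecord₈ θ.rechart` is def-B's `betaOfMerged (betaMerged F ℰ (suChartMap N) e) …`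
at ℰ = the merged term family of record, `e` = the standard basis — the displayed non-degenerate chart instance, for every `N`.
[cite: Balaban1987RG1, (1.20)–(1.22) p.264 (bookkeeping)] -/
theorem betaOfRecord₈_rechart (θ : Stage8Params F N) :
    betaOfRecord₈ F N θ.rechart =
      betaOfMerged (betaMerged F (mergedTermFamilyMat F N (chi7 F N θ.rechart) θ.εbg) (suChartMap N) (Pi.basisFun ℝ (Fin (suChartDim N))))
        (beta0OfMerged (betaMerged F (mergedTermFamilyMat F N (chi7 F N θ.rechart) θ.εbg) (suChartMap N) (Pi.basisFun ℝ (Fin (suChartDim N))))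
          θ.v₀)
        θ.γ := rfl

variable (F N)

/-- **Every admissible Stage-8 parameter, RE-CHARTED, is a ₈X record at some world**, with any window `0 < γw ≤ θ.γ`.
[cite: Balaban1989LargeFieldII, Thm 1 + (0.1) pp.355–356 (bookkeeping)] -/
theorem isRecordOfRecord₈X_rechart (θ : Stage8Params F N) (hθ : θ.Admissible) {γw : ℝ} (hγw : 0 < γw ∧ γw ≤ θ.γ) :
    ∃ w : WorldP, IsRecordOfRecord₈X F N (datumOfRecord₅ F N (θ.rechart.toStage5 F N)) w ∧ w.γ = γw :=
  exists_world_isRecordOfRecord₈X F N θ.rechart (θ.admissible_rechart_iff.mpr hθ) one_pos θ.isChartOfRecord_rechart hγw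

/-- INHABITED-AT-₈X through the chart OF RECORD (every `F`, every `N ≥ 1`; all non-chart objects DEGENERATE as in `Record8Inhabited` — NOT objects of record).
[cite: Balaban1987RG1, (1.20)–(1.22) p.264 (bookkeeping witness)] -/
theorem exists_isRecordOfRecord₈X_rechart :
    ∃ (θ : Stage8Params F N) (w : WorldP), θ.Admissible ∧ IsRecordOfRecord₈X F N (datumOfRecord₅ F N (θ.rechart.toStage5 F N)) w := by
  obtain ⟨θ, hθ, -, hγ, -⟩ := Record8Inhabited.exists_admissible_stage8Params_zeroChart F N 1 one_pos
  obtain ⟨w, hw, -⟩ := isRecordOfRecord₈X_rechart F N θ hθ (γw := 1) ⟨one_pos, by rw [hγ]⟩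
  exact ⟨θ, w, hθ, hw⟩

/-! ## §3. The record predicate CHARTED BY DEFINITION: `IsRecordOfRecord₈R` (pins, not guards) — refines ₈X, hence ₈C ∕ ₇C ∕ ₅C ∕ ₀ -/

/-- **«(D, w) is the record, Stage 8, charted BY DEFINITION»**: the Stage-8 record predicate whose witnessing parameter is RE-CHARTED by the chart of record
(`θ.rechart`: `ρ8 := suChartMap N`, standard basis) — no chart is quantified over.  The shape a Stage-9 predicate built WITHOUT chart fields refines by name.
[cite: Balaban1987RG1, (0.17)–(0.22) pp.255–256 and (1.20)–(1.22) p.264; Balaban1989LargeFieldII, Thm 1 p.355 (objects of record, Stage 8 + the chart of record)] -/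
def IsRecordOfRecord₈R (D : FiniteEpsData F (SU N)) (w : WorldP) : Prop :=
  ∃ θ : Stage8Params F N, θ.Admissible ∧ D = datumOfRecord₅ F N (θ.rechart.toStage5 F N) ∧ w.C = D.C ∧ (0 < w.γ ∧ w.γ ≤ θ.γ) ∧ w.L = (θ.L : ℝ) ∧
    ∀ P : B12.RunParams, w.up P = upOfRecord₅C F N (θ.rechart.toStage5 F N) P

variable {F N}

/-- **Refinement `IsRecordOfRecord₈R → IsRecordOfRecord₈X`** (witness `θ.rechart`, `c = 1`, `isChartOfRecord_rechart`). [cite: Balaban1987RG1, (1.20)–(1.21) p.264 (bookkeeping)] -/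
theorem isRecordOfRecord₈X_of_isRecordOfRecord₈R {D : FiniteEpsData F (SU N)} {w : WorldP} (h : IsRecordOfRecord₈R F N D w) :
    IsRecordOfRecord₈X F N D w := by
  obtain ⟨θ, hθ, hD, hC, hγ, hL, hup⟩ := h
  exact ⟨θ.rechart, 1, θ.admissible_rechart_iff.mpr hθ, one_pos, θ.isChartOfRecord_rechart, hD, hC, hγ, hL, hup⟩

/-- … hence `→ IsRecordOfRecord₈C` (and on to ₇C ∕ ₅C ∕ ₀ by the landed refinements). [cite: Balaban1987RG1, (0.22) p.256 (bookkeeping)] -/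
theorem isRecordOfRecord₈C_of_isRecordOfRecord₈R {D : FiniteEpsData F (SU N)} {w : WorldP} (h : IsRecordOfRecord₈R F N D w) :
    IsRecordOfRecord₈C F N D w :=
  isRecordOfRecord₈C_of_isRecordOfRecord₈X (isRecordOfRecord₈X_of_isRecordOfRecord₈R h)

/-- **What a ₈R record's β IS**: the Stage-8 β of record READ THROUGH THE CHART OF RECORD (`betaOfRecord₈_rechart`), at admissible parameters.
[cite: Balaban1987RG1, (1.20)–(1.22) p.264 (bookkeeping)] -/
theorem exists_βfun_of_isRecordOfRecord₈R {D : FiniteEpsData F (SU N)} {w : WorldP} (h : IsRecordOfRecord₈R F N D w) :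
    ∃ θ : Stage8Params F N, θ.Admissible ∧ D = datumOfRecord₅ F N (θ.rechart.toStage5 F N) ∧ D.βfun = betaOfRecord₈ F N θ.rechart ∧
      0 < w.γ ∧ w.γ ≤ θ.γ := by
  obtain ⟨θ, hθ, hD, -, ⟨hγ0, hγle⟩, -, -⟩ := h
  subst hD
  exact ⟨θ, hθ, rfl, βfun_stage8 F N θ.rechart, hγ0, hγle⟩

variable (F N)

/-- **Pointed form**: admissible `θ`, re-charted, with a world bound to its construction, a window `0 < w.γ ≤ θ.γ`, `θ.L` and `upOfRecord₅C`, IS a ₈R record.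
[cite: Balaban1989LargeFieldII, Thm 1 + (0.1) pp.355–356 (bookkeeping)] -/
theorem isRecordOfRecord₈R_of_eq (θ : Stage8Params F N) (hθ : θ.Admissible) (w : WorldP)
    (hC : w.C = (datumOfRecord₅ F N (θ.rechart.toStage5 F N)).C) (hγ : 0 < w.γ ∧ w.γ ≤ θ.γ) (hL : w.L = (θ.L : ℝ))
    (hup : ∀ P, w.up P = upOfRecord₅C F N (θ.rechart.toStage5 F N) P) :
    IsRecordOfRecord₈R F N (datumOfRecord₅ F N (θ.rechart.toStage5 F N)) w :=
  ⟨θ, hθ, rfl, hC, hγ, hL, hup⟩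

/-- **INHABITED-AT-₈R** (every `F`, every `N ≥ 1`; non-chart objects DEGENERATE as in `Record8Inhabited` — NOT objects of record; nothing of Bałaban's asserted).
[cite: Balaban1987RG1, (0.17)–(0.22) pp.255–256 and (1.20)–(1.22) p.264 (bookkeeping witness)] -/
theorem exists_isRecordOfRecord₈R : ∃ (D : FiniteEpsData F (SU N)) (w : WorldP), IsRecordOfRecord₈R F N D w := by
  obtain ⟨θ, hθ, -, hγ, -⟩ := Record8Inhabited.exists_admissible_stage8Params_zeroChart F N 1 one_pos
  obtain ⟨w₀⟩ := nonempty_worldP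
  exact ⟨_, { w₀ with
      C := (datumOfRecord₅ F N (θ.rechart.toStage5 F N)).C, γ := 1, L := (θ.L : ℝ), one_lt_L := by exact_mod_cast θ.hL.2,
      up := fun P => upOfRecord₅C F N (θ.rechart.toStage5 F N) P },
    isRecordOfRecord₈R_of_eq F N θ hθ _ rfl ⟨one_pos, by rw [hγ]⟩ rfl fun _ => rfl⟩

end Literature.MathematicalPhysics.QuantumFieldTheory.Balaban1983to89.Node00

end
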